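import Literature.Topology.FourManifolds.InteriorDiscs
import Mathlib.Analysis.Normed.Module.HahnBanach
import HarnessLib

/-!
# A connected sum along Kervaire–Milnor's relation forces the norm to be smooth

Topic `Literature/Topology/FourManifolds` (brick [B1] of the discharge of
`Literature.Topology.FourManifolds.nonempty_diffeomorph_of_isOrientedConnectedSum` at arbitrary
models, see `ConnectedSumUniquenessProofs.lean`).

Kervaire–Milnor's relation `i₁ (t u) ∼ i₂ ((1 - t) u)` (`‖u‖ = 1`, `0 < t < 1`;
`Literature.Topology.FourManifolds.connectedSumRel`) identifies the punctured unit discs along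
the inversion `σ v = (‖v‖⁻¹ - 1) v`. The tree states it over an *arbitrary* finite-dimensional
real normed space `E`, whose norm need not be smooth; but if a manifold `P` *is* an open gluing
of `M ∖ k₁(0)` and `N ∖ k₂(0)` along this relation (through smooth embeddings `jA`, `jB` with
open ranges), then `σ = k₂⁻¹ ∘ jB⁻¹ ∘ jA ∘ k₁` is `C^∞` on the punctured unit disc (the inverses
of the open smooth embeddings `jB`, `k₂` being smooth on their ranges: descent of smoothness,
`contMDiffAt_of_comp_isImmersionAt`, and `contMDiffOn_symm_disc`), hence so is
`v ↦ ‖v‖⁻¹ v = σ v + v`, hence (testing against a functional `ℓ` with `ℓ v ≠ 0`, Hahn–Banach)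
so is `v ↦ ‖v‖`, on the punctured disc and then, by homogeneity, on `E ∖ {0}`
(`Literature.Topology.FourManifolds.contDiffOn_norm_of_isOpenGluing_connectedSumRel`). This is
the (only) regularity input needed to compare gluings along differently shaped discs
(`ConnectedSumShape.lean`). Everything is proved; no named facts.
-/

open scoped Manifold ContDiff Topology
open Set Function Filter Metric

noncomputable section

namespace Literature.Topology.FourManifolds

section NormSmooth

variable {E : Type*} [NormedAddCommGroup E] [NormedSpace ℝ E] [FiniteDimensional ℝ E]
  {HM HN HP : Type*} [TopologicalSpace HM] [TopologicalSpace HN] [TopologicalSpace HP]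
  {IM : ModelWithCorners ℝ E HM} {IN : ModelWithCorners ℝ E HN} {IP : ModelWithCorners ℝ E HP}
  {M N P : Type*} [TopologicalSpace M] [T2Space M] [ChartedSpace HM M]
  [TopologicalSpace N] [T2Space N] [ChartedSpace HN N] [IsManifold IN ∞ N]
  [TopologicalSpace P] [ChartedSpace HP P]

/-- **Smoothness of the disc inversion from a gluing.** If `P` is an open gluing of
`M ∖ k₁(0)` and `N ∖ k₂(0)` along Kervaire–Milnor's relation for the discs `k₁`, `k₂`, then
the inversion `v ↦ (‖v‖⁻¹ - 1) v` is `C^∞` on the punctured unit disc of `E`: it factors as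
`k₂⁻¹ ∘ jB⁻¹ ∘ jA ∘ k₁` there. [folklore] -/
theorem contDiffOn_discInversion_of_isOpenGluing_connectedSumRel [Nontrivial E]
    {k₁ : E → M} {k₂ : E → N} (hk₁ : Manifold.IsSmoothEmbedding 𝓘(ℝ, E) IM ∞ k₁)
    (hk₂ : Manifold.IsSmoothEmbedding 𝓘(ℝ, E) IN ∞ k₂)
    (h : IsOpenGluing IM IN IP (A := puncture k₁) (B := puncture k₂) (P := P)
      (connectedSumRel k₁ k₂)) :
    ContDiffOn ℝ ∞ (fun v : E => (‖v‖⁻¹ - 1) • v) {v : E | 0 < ‖v‖ ∧ ‖v‖ < 1} := by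
  obtain ⟨jA, jB, hA, -, hB, hBo, -, hR⟩ := h
  have hk₁i : Injective k₁ := hk₁.isEmbedding.injective
  have hk₂i : Injective k₂ := hk₂.isEmbedding.injective
  obtain ⟨e, he⟩ := exists_ne (0 : E)
  -- the relation: `jA (k₁ v) = jB (k₂ (σ v))` on the punctured unit disc
  have hrel : ∀ (v : E) (h0 : 0 < ‖v‖) (h1 : ‖v‖ < 1) (ha : k₁ v ∈ puncture k₁)
      (hb : k₂ ((‖v‖⁻¹ - 1) • v) ∈ puncture k₂), jA ⟨k₁ v, ha⟩ = jB ⟨_, hb⟩ := by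
    intro v h0 h1 ha hb
    refine (hR _ _).2 ⟨‖v‖⁻¹ • v, ‖v‖, ?_, ⟨h0, h1⟩, ?_, ?_⟩
    · rw [norm_smul, norm_inv, norm_norm, inv_mul_cancel₀ h0.ne']
    · show k₁ v = _
      rw [smul_smul, mul_inv_cancel₀ h0.ne', one_smul]
    · show k₂ _ = _
      rw [smul_smul]; congr 2; field_simp
  -- lifts into the punctured pieces
  classical
  let liftA : E → puncture k₁ := fun v =>
    if hv : v ≠ 0 then ⟨k₁ v, fun h' => hv (hk₁i h')⟩ else ⟨k₁ e, fun h' => he (hk₁i h')⟩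
  have hliftA : ∀ v : E, v ≠ 0 → (liftA v : M) = k₁ v := fun v hv => by
    simp [liftA, hv]
  -- `F = jA ∘ liftA` is smooth away from `0`
  have hF : ∀ v₀ : E, v₀ ≠ 0 → ContMDiffAt 𝓘(ℝ, E) IP ∞ (jA ∘ liftA) v₀ := by
    intro v₀ hv₀
    refine hA.contMDiff.contMDiffAt.comp v₀ ?_
    rw [← ContMDiffAt.subtypeVal_comp_iff]
    have hev : (Subtype.val ∘ liftA) =ᶠ[𝓝 v₀] k₁ := by
      filter_upwards [isOpen_compl_singleton.mem_nhds hv₀] with v hv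
      exact hliftA v hv
    exact hk₁.contMDiff.contMDiffAt.congr_of_eventuallyEq hev
  -- a left inverse `G` of `jB`, smooth at points of `range jB`
  haveI : Nonempty (puncture k₂) := ⟨⟨k₂ e, fun h' => he (hk₂i h')⟩⟩
  let G : P → puncture k₂ := Function.invFun jB
  have hGj : ∀ b, G (jB b) = b := Function.leftInverse_invFun hB.isEmbedding.injective
  have hjBo : IsOpenMap jB := (Topology.IsOpenEmbedding.mk hB.isEmbedding hBo).isOpenMap
  have hG : ∀ b, ContMDiffAt IP IN ∞ G (jB b) := fun b =>
    contMDiffAt_of_comp_isImmersionAt (hB.isImmersion.isImmersionAt b) hjBo contMDiffAt_id hGj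
  -- a left inverse `K` of `k₂`, smooth on `range k₂`
  set Φ := (isOpenEmbedding_disc hk₂).toOpenPartialHomeomorph k₂ with hΦ
  have hK : ContMDiffOn IN 𝓘(ℝ, E) ∞ Φ.symm (range k₂) := contMDiffOn_symm_disc hk₂
  have hKk : ∀ v, Φ.symm (k₂ v) = v := fun v =>
    (isOpenEmbedding_disc hk₂).toOpenPartialHomeomorph_left_inv
  -- `σ = K ∘ val ∘ G ∘ F` on the punctured disc
  intro v₀ hv₀
  have hv₀0 : v₀ ≠ 0 := norm_pos_iff.1 hv₀.1
  have hopen : IsOpen {v : E | 0 < ‖v‖ ∧ ‖v‖ < 1} := by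
    have : {v : E | 0 < ‖v‖ ∧ ‖v‖ < 1} = (fun v : E => ‖v‖) ⁻¹' Ioo 0 1 := rfl
    rw [this]; exact isOpen_Ioo.preimage continuous_norm
  suffices hs : ContDiffAt ℝ ∞ (fun v : E => (‖v‖⁻¹ - 1) • v) v₀ from hs.contDiffWithinAt
  have hev : (fun v : E => (‖v‖⁻¹ - 1) • v) =ᶠ[𝓝 v₀]
      Φ.symm ∘ Subtype.val ∘ G ∘ (jA ∘ liftA) := by
    filter_upwards [hopen.mem_nhds hv₀] with v hv
    have hv0 : v ≠ 0 := norm_pos_iff.1 hv.1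
    have hb : k₂ ((‖v‖⁻¹ - 1) • v) ∈ puncture k₂ := by
      rw [mem_puncture]; intro h'
      have h2 := hk₂i h'
      rw [smul_eq_zero] at h2
      rcases h2 with h2 | h2
      · have : (1 : ℝ) < ‖v‖⁻¹ := (one_lt_inv₀ hv.1).2 hv.2
        linarith
      · exact hv0 h2
    have h1 : jA (liftA v) = jB ⟨_, hb⟩ := by
      have ha : k₁ v ∈ puncture k₁ := by
        rw [mem_puncture]; exact fun h' => hv0 (hk₁i h')
      have : liftA v = ⟨k₁ v, ha⟩ := Subtype.ext (hliftA v hv0)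
      rw [this]
      exact hrel v hv.1 hv.2 ha hb
    simp only [comp_apply, h1, hGj]
    exact (hKk _).symm
  refine ContMDiffAt.contDiffAt (ContMDiffAt.congr_of_eventuallyEq ?_ hev)
  have h1 := hF v₀ hv₀0
  have h2 : ContMDiffAt IP IN ∞ G ((jA ∘ liftA) v₀) := by
    have hb : k₂ ((‖v₀‖⁻¹ - 1) • v₀) ∈ puncture k₂ := by
      rw [mem_puncture]; intro h'
      have h2 := hk₂i h'
      rw [smul_eq_zero] at h2
      rcases h2 with h2 | h2
      · have : (1 : ℝ) < ‖v₀‖⁻¹ := (one_lt_inv₀ hv₀.1).2 hv₀.2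
        linarith
      · exact hv₀0 h2
    have ha : k₁ v₀ ∈ puncture k₁ := by
      rw [mem_puncture]; exact fun h' => hv₀0 (hk₁i h')
    have : (jA ∘ liftA) v₀ = jB ⟨_, hb⟩ := by
      show jA (liftA v₀) = _
      have : liftA v₀ = ⟨k₁ v₀, ha⟩ := Subtype.ext (hliftA v₀ hv₀0)
      rw [this]
      exact hrel v₀ hv₀.1 hv₀.2 ha hb
    rw [this]
    exact hG _
  have h3 : ContMDiffAt IN 𝓘(ℝ, E) ∞ (Φ.symm ∘ Subtype.val) ((G ∘ (jA ∘ liftA)) v₀) := by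
    refine (hK.contMDiffAt ((isOpenMap_disc hk₂).isOpen_range.mem_nhds ?_)).comp _
      (contMDiff_subtype_val (I := IN) (n := ∞)).contMDiffAt
    -- the value lies in `range k₂`
    have hb : k₂ ((‖v₀‖⁻¹ - 1) • v₀) ∈ puncture k₂ := by
      rw [mem_puncture]; intro h'
      have h2 := hk₂i h'
      rw [smul_eq_zero] at h2
      rcases h2 with h2 | h2
      · have : (1 : ℝ) < ‖v₀‖⁻¹ := (one_lt_inv₀ hv₀.1).2 hv₀.2
        linarith
      · exact hv₀0 h2
    have ha : k₁ v₀ ∈ puncture k₁ := by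
      rw [mem_puncture]; exact fun h' => hv₀0 (hk₁i h')
    have e1 : (G ∘ (jA ∘ liftA)) v₀ = ⟨_, hb⟩ := by
      show G (jA (liftA v₀)) = _
      have : liftA v₀ = ⟨k₁ v₀, ha⟩ := Subtype.ext (hliftA v₀ hv₀0)
      rw [this, hrel v₀ hv₀.1 hv₀.2 ha hb, hGj]
    rw [e1]
    exact mem_range_self _
  exact h3.comp v₀ (h2.comp v₀ h1)

/-- **A gluing along Kervaire–Milnor's relation forces the norm to be smooth away from `0`.**
If some manifold is an open gluing of `M ∖ k₁(0)` and `N ∖ k₂(0)` along `connectedSumRel k₁ k₂`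
(discs `k₁`, `k₂` in Hausdorff manifolds with arbitrary models, `E ≠ 0`), then `v ↦ ‖v‖` is
`C^∞` on `E ∖ {0}`: on the punctured unit disc `‖v‖⁻¹ v = σ v + v` is smooth, so
`‖v‖⁻¹ = ℓ (‖v‖⁻¹ v) / ℓ v` is smooth near any `v` with `ℓ v ≠ 0` (`ℓ` from Hahn–Banach), and
homogeneity covers `E ∖ {0}`. [folklore] -/
theorem contDiffOn_norm_of_isOpenGluing_connectedSumRel [Nontrivial E]
    {k₁ : E → M} {k₂ : E → N} (hk₁ : Manifold.IsSmoothEmbedding 𝓘(ℝ, E) IM ∞ k₁)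
    (hk₂ : Manifold.IsSmoothEmbedding 𝓘(ℝ, E) IN ∞ k₂)
    (h : IsOpenGluing IM IN IP (A := puncture k₁) (B := puncture k₂) (P := P)
      (connectedSumRel k₁ k₂)) :
    ContDiffOn ℝ ∞ (fun v : E => ‖v‖) {0}ᶜ := by
  have hσ := contDiffOn_discInversion_of_isOpenGluing_connectedSumRel hk₁ hk₂ h
  have hopen : IsOpen {v : E | 0 < ‖v‖ ∧ ‖v‖ < 1} := by
    have : {v : E | 0 < ‖v‖ ∧ ‖v‖ < 1} = (fun v : E => ‖v‖) ⁻¹' Ioo 0 1 := rfl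
    rw [this]; exact isOpen_Ioo.preimage continuous_norm
  -- Step 1: the norm is smooth on the punctured unit disc
  have hdisc : ∀ v₀ : E, 0 < ‖v₀‖ → ‖v₀‖ < 1 → ContDiffAt ℝ ∞ (fun v : E => ‖v‖) v₀ := by
    intro v₀ h0 h1
    have hv₀ : v₀ ≠ 0 := norm_pos_iff.1 h0
    -- `v ↦ ‖v‖⁻¹ • v` is smooth near `v₀`
    have hu : ContDiffAt ℝ ∞ (fun v : E => ‖v‖⁻¹ • v) v₀ := by
      have h2 : ContDiffAt ℝ ∞ (fun v : E => (‖v‖⁻¹ - 1) • v + v) v₀ :=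
        (hσ.contDiffAt (hopen.mem_nhds ⟨h0, h1⟩)).add contDiffAt_id
      refine h2.congr_of_eventuallyEq (Filter.Eventually.of_forall fun v => ?_)
      simp only [sub_smul, one_smul, sub_add_cancel]
    -- test against a functional with `ℓ v₀ ≠ 0`
    obtain ⟨ℓ, -, hℓ⟩ := exists_dual_vector ℝ v₀ (norm_ne_zero_iff.2 hv₀)
    have hℓ0 : ℓ v₀ ≠ 0 := by rw [hℓ]; exact_mod_cast h0.ne'
    have hℓo : ∀ᶠ v in 𝓝 v₀, ℓ v ≠ 0 :=
      (ℓ.continuous.continuousAt.eventually_ne hℓ0)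
    have hinv : ContDiffAt ℝ ∞ (fun v : E => ‖v‖⁻¹) v₀ := by
      have h3 : ContDiffAt ℝ ∞ (fun v : E => ℓ (‖v‖⁻¹ • v) / ℓ v) v₀ :=
        (ℓ.contDiff.contDiffAt.comp v₀ hu).div ℓ.contDiff.contDiffAt hℓ0
      refine h3.congr_of_eventuallyEq ?_
      filter_upwards [hℓo] with v hv
      rw [map_smul, smul_eq_mul, mul_div_assoc, div_self hv, mul_one]
    have h4 : ContDiffAt ℝ ∞ (fun v : E => (‖v‖⁻¹)⁻¹) v₀ := hinv.inv (by simpa using h0.ne')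
    exact h4.congr_of_eventuallyEq (Filter.Eventually.of_forall fun v => by simp)
  -- Step 2: homogeneity
  intro v₀ hv₀
  have hv₀' : v₀ ≠ 0 := hv₀
  have h0 : 0 < ‖v₀‖ := norm_pos_iff.2 hv₀'
  set R : ℝ := 2 * ‖v₀‖ with hR
  have hR0 : 0 < R := by positivity
  have hw : 0 < ‖R⁻¹ • v₀‖ ∧ ‖R⁻¹ • v₀‖ < 1 := by
    rw [norm_smul, norm_inv, Real.norm_of_nonneg hR0.le, hR]
    constructor
    · positivity
    · field_simp; linarith
  have h1 : ContDiffAt ℝ ∞ (fun v : E => R * ‖R⁻¹ • v‖) v₀ :=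
    contDiffAt_const.mul ((hdisc _ hw.1 hw.2).comp v₀ (contDiffAt_const.smul contDiffAt_id))
  refine (h1.congr_of_eventuallyEq (Filter.Eventually.of_forall fun v => ?_)).contDiffWithinAt
  show ‖v‖ = R * ‖R⁻¹ • v‖
  rw [norm_smul, norm_inv, Real.norm_of_nonneg hR0.le, ← mul_assoc, mul_inv_cancel₀ hR0.ne',
    one_mul]

end NormSmooth

end Literature.Topology.FourManifolds
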